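import Literature.AlgebraicGeometry.ShimuraVarieties.UnitaryShimuraLevelFibres
import Literature.AlgebraicGeometry.ShimuraVarieties.UnitaryShimuraCurveEmbeddingPoints
import Literature.AlgebraicGeometry.Morphisms.ClopenPieceOfCoproduct
import Literature.AlgebraicGeometry.HodgeTheory.GysinFormalism
import HarnessLib

/-!
# The pieces of `(M_K)_τ` under a Hecke translate `T_b`: points, matching isomorphism of pieces, and `H¹`
# ([Deligne1979ShimuraVarieties] 2.1.2–2.1.4; [Milne2005ShimuraVarieties] Lemma 5.13, §13 Thm. 13.6 p. 118)

Topic `AlgebraicGeometry/ShimuraVarieties`; namespaces `Literature.AlgebraicGeometry.Morphisms` (§1, generic) and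
`Literature.AlgebraicGeometry.ShimuraVarieties.UnitaryCanonicalModel` (§2, the rank-3 ★ `RecordSystem`).  PROOF FILE: theorems only —
no definition, no named fact, no instance, no `sorry`.

Let `S : RecordSystem L H τ T hT K₀` be Deligne's canonical model of `Sh(U(H), 𝔹²)` (`UnitaryShimuraCanonicalModel.lean`) and
`T_b : M_{Λ} ⟶ M_{K″}` a Hecke translate, `S.IsHeckeTranslate Λ K″ b T_b` ([Milne2005ShimuraVarieties] p. 118 L21–26 «`T(g) : [x, aK] ↦ [x, agK′]`»).
The complex fibre `(M_K)_τ` is a finite coproduct of compact ball quotients `X_q ≅ Γ_{g_q}∖𝔹²` indexed by `Ξ_K = U(H)(L⁺)∖U(H)(𝔸_{L⁺,f})/K`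
([Deligne1979ShimuraVarieties] 2.1.2 «une somme disjointe, indexée par `G(ℚ)∖G(𝔸^f)/K`, de quotients `Γ_g∖X⁺`»; tree: the clause
`RecordSystem.pieces` / ★ `HComp.RecordSystem.exists_pieces`, each piece `ι_q : X_q ⟶ (M_K)_τ` carrying a `UnitaryBallUniformisationDatum 2`
with `Hℂ = H^τ` and `ι_q (unif (T·(z,1))) = [z, g_q K]`).  This file proves the POINT-SET and COHOMOLOGICAL bookkeeping of `T_b` against ONE such
presentation per level (no identification of two presentations, no rational-`γ` bookkeeping):

* §1 (generic, any base `B`): `Morphisms.exists_overIso_piece_of_iso_apex` — for colimit cofans `inj_c : Y_c ⟶ X′`, `inj″_d : Y″_d ⟶ X″` with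
  (pre)connected summands and an isomorphism `Φ : X′ ≅ X″` of the apexes, ONE point of `inj_c(Y_c)` landing in `inj″_{c″}(Y″_{c″})` forces a
  unique matching isomorphism `φ : Y_c ≅ Y″_{c″}` with `φ ≫ inj″_{c″} = inj_c ≫ Φ` (★ `exists_overIso_comp_eq_of_isColimit_cofan` + disjointness of
  the legs, [GortzWedhorn2020] §(3.5) Ex. 3.11); `…_of_geometricallyIrreducible` (the tree's `IsSmoothProjective` pieces); and on
  `Hⁿ(–(ℂ); ℂ)` (`HodgeTheory.complexBetti`): `complexBetti_map_inj_map_iso_apply` (the square) and **`complexBetti_map_inj_ne_zero_of_iso`**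
  «`x|_{Y″_{c″}} ≠ 0 ⇒ (Φ^* x)|_{Y_c} ≠ 0`» ([HatcherAT2002] §3.1: an isomorphism induces an isomorphism on cohomology).
* §2 (rank 3): `UnitaryCanonicalModel.range_map_eq_of_unif_eq` — the complex points of a piece are EXACTLY the `[z, g_q K]`, `z ∈ 𝔹²` (the `pieces`
  third clause + `surjOn_unif` + ★ `negConeToBall`/`lift_proj`); `ShimuraSet.range_mk_eq_of_mk_pt_eq` — the set `{[z, aK] : z}` depends only on
  the class of `a` in `Ξ_K`; **`RecordSystem.image_baseChange_heckeTranslate_range_piece`** (L1) — `(T_b)_τ` maps the complex points of the piece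
  of `(M_Λ)_τ` through `a` ONTO those of the piece of `(M_{K″})_τ` through any representative of `[ab]_{K″}` (★ `map_heckeTranslate_pts_symm_mk`,
  ★ `HodgeTheory.baseChangeEquiv_map`); **`RecordSystem.exists_pieceIso_of_heckeTranslateIso`** (L3) — if `T_b = e.hom` for an isomorphism of levels
  `e : M_Λ ≅ M_{K″}` (the conjugate-level situation `Λ = bK″b⁻¹` of [Milne2005ShimuraVarieties] Thm. 13.6; the (7d) L2 leaf `UnitaryShimuraHeckeTranslateIso.lean`, not imported),
  the two pieces are ISOMORPHIC compatibly with `(T_b)_τ`, and **`RecordSystem.complexBetti_map_piece_ne_zero_of_heckeTranslateIso`** — a class on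
  `(M_{K″})_τ(ℂ)` non-zero on the piece `[ab]` pulls back under `(T_b)_τ` to a class non-zero on the piece `[a]` (at `n = 1` this is the tree's
  `schemeBettiH1Along`/`schemeBettiPullAlong` currency by `rfl`).

Cell `hodgecm-mathlib` (D-0151), crux `HLiu418` (24832), GS programme node (7d) «component/level bookkeeping» of A-plan2's memo
`GS-PROGRAMME.md` A.13 ADDENDUM 2 (β′), lemmas L1 + L3 (L2 + L4 = `UnitaryShimuraHeckeTranslateIso.lean`, not imported; L5 is `rfl` for the
GS-7 lead).  HC_CM is NOT proved here and nothing in this file discharges a printed-citation binder by itself.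

## References
* [Deligne1979ShimuraVarieties] P. Deligne, *Variétés de Shimura* (1979), 2.1.2–2.1.4 (Milne's translation, PDF p. 24).
* [Milne2005ShimuraVarieties] J. S. Milne, *Introduction to Shimura varieties* (rev. 2017): Lemma 5.13 p. 57, §5 p. 58 L3–11, §13 Thm. 13.6 p. 118 L21–28.
* [GortzWedhorn2020] U. Görtz, T. Wedhorn, *Algebraic Geometry I* (2nd ed.), §(3.5) Example 3.11, Exercise 3.16 (coproducts of schemes).
* [HatcherAT2002] A. Hatcher, *Algebraic Topology*, §3.1 (functoriality of cohomology; p. 201–202).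
* [BergeronMillsonMoeglin2016Balls] N. Bergeron, J. Millson, C. Moeglin, Acta Math. 216 (2016), Introduction §1.1, Part 2 §1.3 (ball quotients `Γ∖𝔹`).
-/

set_option autoImplicit false

noncomputable section

/-! ## §1. Generic: matching a piece of one coproduct with a piece of another along an isomorphism of the apexes -/

namespace Literature.AlgebraicGeometry.Morphisms

open _root_.CategoryTheory _root_.CategoryTheory.Limits _root_.AlgebraicGeometry _root_.Set _root_.Function _root_.Topology

universe v u

section Over

variable {σ σ' : Type v} [Small.{u} σ] [Small.{u} σ'] {B : Scheme.{u}}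
  {X : σ → Over B} {S : Over B} {f : ∀ i, X i ⟶ S}
  {X' : σ' → Over B} {S' : Over B} {f' : ∀ i, X' i ⟶ S'}

/-- The range of `g ≫ Φ.hom` (on underlying spaces) is the preimage of the range of `g` under `Φ.inv`, for an isomorphism `Φ`
of `B`-schemes. [cite: GortzWedhorn2020, §(3.5) Example 3.11] -/
theorem range_comp_iso_hom_left {E : Over B} (g : E ⟶ S) (Φ : S ≅ S') :
    Set.range (g ≫ Φ.hom).left = Φ.inv.left ⁻¹' Set.range g.left := by
  have hcomp : ∀ y, (g ≫ Φ.hom).left y = Φ.hom.left (g.left y) := fun y => by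
    rw [Over.comp_left, Scheme.Hom.comp_apply]
  have hinv : ∀ s, Φ.inv.left (Φ.hom.left s) = s := fun s => by
    rw [← Scheme.Hom.comp_apply, ← Over.comp_left, Iso.hom_inv_id, Over.id_left]; rfl
  have hinv' : ∀ s', Φ.hom.left (Φ.inv.left s') = s' := fun s' => by
    rw [← Scheme.Hom.comp_apply, ← Over.comp_left, Iso.inv_hom_id, Over.id_left]; rfl
  ext z
  exact ⟨fun ⟨y, hy⟩ => ⟨y, by rw [← hy, hcomp, hinv]⟩, fun ⟨y, hy⟩ => ⟨y, by rw [hcomp, hy, hinv']⟩⟩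

/-- **Matching a piece along an isomorphism of the apexes.**  Let `(f_i : X_i ⟶ S)` and `(f′_j : X′_j ⟶ S′)` be colimit cofans in `Over B`
(coproducts of `B`-schemes) with `X_c` connected and every `X′_j` preconnected, and `Φ : S ≅ S′` an isomorphism.  If ONE point of the image of
`X_c` is carried by `Φ` into the image of `X′_{c′}`, then `Φ` restricts to an isomorphism `φ : X_c ≅ X′_{c′}` over the apexes:
`φ ≫ f′_{c′} = f_c ≫ Φ`.  (The image of `X_c` under `f_c ≫ Φ` is a connected open-and-closed piece of `S′`, hence one of the summands —
★ `exists_overIso_comp_eq_of_isColimit_cofan` — and the summand is `X′_{c′}` because the images of distinct legs are disjoint.)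
[cite: GortzWedhorn2020, Lemma 1.19 (1) (§(1.5)) with §(3.5) Example 3.11 and Exercise 3.16] -/
theorem exists_overIso_piece_of_iso_apex (hc : IsColimit (Cofan.mk S f)) (hc' : IsColimit (Cofan.mk S' f'))
    [∀ j, PreconnectedSpace (X' j).left] (c : σ) [ConnectedSpace (X c).left] (c' : σ') (Φ : S ≅ S')
    {x : (X c).left} (hx : Φ.hom.left ((f c).left x) ∈ Set.range (f' c').left) :
    ∃ φ : X c ≅ X' c', φ.hom ≫ f' c' = f c ≫ Φ.hom := by
  obtain ⟨hcl⟩ := isColimit_cofan_left hc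
  obtain ⟨hcl'⟩ := isColimit_cofan_left hc'
  haveI : IsOpenImmersion (f c).left := isOpenImmersion_of_isColimit_cofan hcl c
  haveI : IsIso Φ.hom.left := (inferInstance : IsIso ((Over.forget B).mapIso Φ).hom)
  haveI : IsOpenImmersion (f c ≫ Φ.hom).left := by rw [Over.comp_left]; infer_instance
  have hclosed : IsClosed (Set.range (f c ≫ Φ.hom).left) := by
    rw [range_comp_iso_hom_left]
    exact ((isClopen_range_of_isColimit_cofan hcl c).preimage (Scheme.Hom.continuous _)).1
  obtain ⟨j, φ, hφ⟩ := exists_overIso_comp_eq_of_isColimit_cofan hc' (f c ≫ Φ.hom) hclosed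
  -- the summand is `X′_{c′}`: the witness point lies in both images
  have hj : j = c' := by
    by_contra hne
    have hmem : Φ.hom.left ((f c).left x) ∈ Set.range (f' j).left := by
      refine ⟨φ.hom.left x, ?_⟩
      have h1 : (f' j).left (φ.hom.left x) = (φ.hom ≫ f' j).left x := by rw [Over.comp_left, Scheme.Hom.comp_apply]
      rw [h1, hφ, Over.comp_left, Scheme.Hom.comp_apply]
    exact Set.disjoint_left.mp (pairwise_disjoint_range_of_isColimit_cofan hcl' hne) hmem hx
  subst hj
  exact ⟨φ, hφ⟩

/-- **Matching a piece along an isomorphism of the apexes — geometrically irreducible summands over a one-point base** (e.g. `B = Spec k`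
and summands with the tree's `IsSmoothProjective`): geometrically irreducible over a point is irreducible, hence connected
(Mathlib `GeometricallyIrreducible.irreducibleSpace_of_subsingleton`). [cite: GortzWedhorn2020, Lemma 1.19 (1) (§(1.5)) with §(3.5) Example 3.11 and Exercise 3.16] -/
theorem exists_overIso_piece_of_iso_apex_of_geometricallyIrreducible [Subsingleton B] [Nonempty B]
    (hc : IsColimit (Cofan.mk S f)) (hc' : IsColimit (Cofan.mk S' f'))
    [∀ j, GeometricallyIrreducible (X' j).hom] (c : σ) [GeometricallyIrreducible (X c).hom] (c' : σ') (Φ : S ≅ S')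
    {x : (X c).left} (hx : Φ.hom.left ((f c).left x) ∈ Set.range (f' c').left) :
    ∃ φ : X c ≅ X' c', φ.hom ≫ f' c' = f c ≫ Φ.hom := by
  haveI : ∀ j, PreconnectedSpace (X' j).left := fun j =>
    haveI := GeometricallyIrreducible.irreducibleSpace_of_subsingleton (X' j).hom
    inferInstance
  haveI : ConnectedSpace (X c).left :=
    haveI := GeometricallyIrreducible.irreducibleSpace_of_subsingleton (X c).hom
    inferInstance
  exact exists_overIso_piece_of_iso_apex hc hc' c c' Φ hx

end Over

section Betti

open Literature.AlgebraicGeometry.HodgeTheory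

variable {σ σ' : Type} {X : σ → Motives.SchemeOver ℂ} {S : Motives.SchemeOver ℂ} {f : ∀ i, X i ⟶ S}
  {X' : σ' → Motives.SchemeOver ℂ} {S' : Motives.SchemeOver ℂ} {f' : ∀ i, X' i ⟶ S'}

/-- **The cohomology square of a matched piece**: for `φ ≫ f′_{c′} = f_c ≫ Φ`, restriction to `X_c` of `Φ^* x` is `φ^*` of the restriction
of `x` to `X′_{c′}` on `Hⁿ(–(ℂ); ℂ)` (functoriality of `complexBetti`). [cite: HatcherAT2002, §3.1 p. 201] -/
theorem complexBetti_map_inj_map_iso_apply {c : σ} {c' : σ'} (Φ : S ⟶ S') (φ : X c ⟶ X' c')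
    (hφ : φ ≫ f' c' = f c ≫ Φ) (n : ℕ) (x : complexBetti S' n) :
    (complexBetti.map (f c) n).hom ((complexBetti.map Φ n).hom x) =
      (complexBetti.map φ n).hom ((complexBetti.map (f' c') n).hom x) := by
  have h := congrArg (fun g => (complexBetti.map g n).hom x) hφ
  simp only [complexBetti.map_comp, ModuleCat.hom_comp, LinearMap.comp_apply] at h
  exact h.symm

/-- **An isomorphism of complex varieties is injective on `Hⁿ(–(ℂ); ℂ)`** (`(φ⁻¹)^* ∘ φ^* = id`). [cite: HatcherAT2002, §3.1 p. 201] -/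
theorem complexBetti_map_iso_hom_injective {Y Y' : Motives.SchemeOver ℂ} (φ : Y ≅ Y') (n : ℕ) :
    Function.Injective (complexBetti.map φ.hom n).hom := by
  intro x y h
  have key : ∀ z : complexBetti Y' n, (complexBetti.map φ.inv n).hom ((complexBetti.map φ.hom n).hom z) = z := fun z => by
    rw [← LinearMap.comp_apply, ← ModuleCat.hom_comp, ← complexBetti.map_comp, Iso.inv_hom_id, complexBetti.map_id]
    rfl
  rw [← key x, ← key y, h]

/-- **Non-vanishing moves along a matched piece**: with `φ : X_c ≅ X′_{c′}`, `φ ≫ f′_{c′} = f_c ≫ Φ`, a class `x ∈ Hⁿ(S′(ℂ); ℂ)` whose restriction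
to the piece `X′_{c′}` is non-zero pulls back under `Φ` to a class whose restriction to the piece `X_c` is non-zero.
[cite: HatcherAT2002, §3.1 p. 201–202] [cite: GortzWedhorn2020, §(3.5) Example 3.11] -/
theorem complexBetti_map_inj_ne_zero_of_iso {c : σ} {c' : σ'} (Φ : S ⟶ S') (φ : X c ≅ X' c')
    (hφ : φ.hom ≫ f' c' = f c ≫ Φ) (n : ℕ) {x : complexBetti S' n} (hx : (complexBetti.map (f' c') n).hom x ≠ 0) :
    (complexBetti.map (f c) n).hom ((complexBetti.map Φ n).hom x) ≠ 0 := by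
  rw [complexBetti_map_inj_map_iso_apply Φ φ.hom hφ n x]
  intro h0
  exact hx (complexBetti_map_iso_hom_injective φ n (h0.trans (map_zero _).symm))

end Betti

end Literature.AlgebraicGeometry.Morphisms

/-! ## §2. Rank 3: the pieces of `(M_K)_τ` under a Hecke translate -/

open Function MulAction Topology NumberField CategoryTheory CategoryTheory.Limits Matrix AlgebraicGeometry
open scoped Matrix ComplexOrder
open Literature.AlgebraicGeometry.Motives
open Literature.NumberTheory.Automorphic Literature.NumberTheory.Automorphic.UnitaryGroup
open Literature.NumberTheory.Automorphic.Liu2021.AppendixC (C5.OpenCompactSubgroup C5.SmallLevel)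
open Literature.Geometry.ComplexHyperbolic Literature.Geometry.ComplexHyperbolic.BallModel
open Literature.NumberTheory.Automorphic.ShimuraDissection

namespace Literature.NumberTheory.Automorphic.UnitaryGroup.ShimuraSet

variable (L : Type) [Field L] [NumberField L] [IsCMField L] (H : Matrix (Fin 3) (Fin 3) L)
  (τ : L →+* ℂ) (T : GL (Fin 3) ℂ) (hT : formCongr (starRingEnd ℂ) T (H.map τ) = BallModel.J)

/-- **The fibre `{[z, aK] : z ∈ 𝔹²}` of `Sh_K(ℂ) → Ξ_K` depends only on the class of `a` in `Ξ_K = U(H)(L⁺)∖U(H)(𝔸_{L⁺,f})/K`**: if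
`U(H)(L⁺)·aK = U(H)(L⁺)·a′K` then `{[z, aK] : z} = {[z, a′K] : z}` (`[γz′, γa′K] = [z′, a′K]`, [Milne2005ShimuraVarieties] Lemma 5.13 footnote
«`[x, a] = [q⁻¹x, g]`»). [cite: Milne2005ShimuraVarieties, Lemma 5.13 p. 57] [cite: Deligne1979ShimuraVarieties, 2.1.2] -/
theorem range_mk_eq_of_mk_pt_eq (K : Subgroup (finAdelic (↥(maximalRealSubfield L)) L (IsCMField.complexConj L) 3 H))
    {a a' : finAdelic (↥(maximalRealSubfield L)) L (IsCMField.complexConj L) 3 H}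
    (h : (Quotient.mk'' (CosetSpace.pt (rationalToFinAdelic _ L _ 3 H) K a) :
        orbitRel.Quotient (rational (↥(maximalRealSubfield L)) L (IsCMField.complexConj L) 3 H)
          (CosetSpace (rationalToFinAdelic (↥(maximalRealSubfield L)) L (IsCMField.complexConj L) 3 H) K)) =
      Quotient.mk'' (CosetSpace.pt (rationalToFinAdelic _ L _ 3 H) K a')) :
    Set.range (fun z : Ball => ShimuraSet.mk L H τ T hT K z a) = Set.range (fun z : Ball => ShimuraSet.mk L H τ T hT K z a') := by
  -- one inclusion from `γ₀ • pt a₁ = pt a₂`, i.e. `a₂ ∈ γ₀ a₁ K`: `[z, a₂K] = [γ₀⁻¹z, a₁K]`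
  have key : ∀ {a₁ a₂ : finAdelic (↥(maximalRealSubfield L)) L (IsCMField.complexConj L) 3 H}
      (γ₀ : rational (↥(maximalRealSubfield L)) L (IsCMField.complexConj L) 3 H),
      γ₀ • CosetSpace.pt (rationalToFinAdelic _ L _ 3 H) K a₁ = CosetSpace.pt (rationalToFinAdelic _ L _ 3 H) K a₂ →
        Set.range (fun z : Ball => ShimuraSet.mk L H τ T hT K z a₂) ⊆
          Set.range (fun z : Ball => ShimuraSet.mk L H τ T hT K z a₁) := by
    intro a₁ a₂ γ₀ h₀
    rw [CosetSpace.smul_pt, CosetSpace.pt_eq_pt_iff] at h₀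
    rintro _ ⟨z, rfl⟩
    refine ⟨ratToU21 L H τ T hT γ₀⁻¹ • z, ?_⟩
    change ShimuraSet.mk L H τ T hT K (ratToU21 L H τ T hT γ₀⁻¹ • z) a₁ = ShimuraSet.mk L H τ T hT K z a₂
    rw [ShimuraSet.mk_eq_mk_iff]
    refine ⟨γ₀⁻¹, rfl, ?_⟩
    rwa [map_inv, ← mul_assoc, ← _root_.mul_inv_rev]
  obtain ⟨γ, hγ⟩ := (Quotient.eq''.trans mem_orbit_iff).mp h   -- `hγ : γ • pt a' = pt a`
  have hγ' : γ⁻¹ • CosetSpace.pt (rationalToFinAdelic _ L _ 3 H) K a =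
      CosetSpace.pt (rationalToFinAdelic _ L _ 3 H) K a' := by
    rw [← hγ, inv_smul_smul]
  exact Set.Subset.antisymm (key γ hγ) (key γ⁻¹ hγ')

end Literature.NumberTheory.Automorphic.UnitaryGroup.ShimuraSet

namespace Literature.AlgebraicGeometry.ShimuraVarieties.UnitaryCanonicalModel

variable {L : Type} [Field L] [NumberField L] [IsCMField L] {H : Matrix (Fin 3) (Fin 3) L}
  {τ : L →+* ℂ} {T : GL (Fin 3) ℂ} {hT : formCongr (starRingEnd ℂ) T (H.map τ) = BallModel.J}
  {K₀ : C5.OpenCompactSubgroup ↥(finAdelic (↥(maximalRealSubfield L)) L (IsCMField.complexConj L) 3 H)}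

/-! ### §2.1 The complex points of a piece are the `[z, g_q K]` -/

omit [NumberField L] [IsCMField L] in
/-- **The complex points of a piece are exactly the classes `[z, g_qK]`, `z ∈ 𝔹²`.**  Let `D : UnitaryBallUniformisationDatum 2 Y` have complex
Gram matrix `H^τ` and let `ι : Y ⟶ X′` satisfy the `pieces` clause `ι (unif (T·(z, 1))) = P z` for all `z ∈ 𝔹²`.  Then the image of `Y(ℂ)`
under `ι` is `{P z : z ∈ 𝔹²}`: every point of `Y(ℂ)` is `unif v` for a negative vector `v` (`surjOn_unif`), and `v` is a non-zero multiple of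
`T·(𝔹(v), 1)` (★ `negConeToBall`, ★ `lift_proj`), on which `unif` is constant (`unif_smul`).
[cite: BergeronMillsonMoeglin2016Balls, Introduction §1.1 and Part 2 §1.3] [cite: Deligne1979ShimuraVarieties, 2.1.2] -/
theorem range_map_eq_of_unif_eq (hT : formCongr (starRingEnd ℂ) T (H.map τ) = BallModel.J)
    {Y X' : SchemeOver ℂ} (D : UnitaryBallUniformisationDatum 2 Y) (hD : D.Hℂ = H.map τ) (ι : Y ⟶ X')
    (P : Ball → ComplexPoints X')
    (hι : ∀ z : Ball, AlgPoints.map (L := ℂ) ι (D.unif ((T : Matrix (Fin 3) (Fin 3) ℂ) *ᵥ BallModel.lift z)) = P z) :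
    Set.range (AlgPoints.map (L := ℂ) ι) = Set.range P := by
  refine Set.Subset.antisymm ?_ ?_
  · rintro _ ⟨Q, rfl⟩
    -- `Q = unif v`, `v` in the cone
    obtain ⟨v, hv, hvQ⟩ := D.surjOn_unif (Set.mem_univ Q)
    have hv' : v ∈ negCone (H.map τ) := by
      rw [← hD]; exact hv
    -- `T · lift (𝔹 v) = c • v` with `c = ((T⁻¹ v) 2)⁻¹ ≠ 0`
    have hQneg := Q_inv_mulVec_neg_of_mem_negCone hT hv'
    have h2 : ((↑T⁻¹ : Matrix (Fin 3) (Fin 3) ℂ) *ᵥ v) 2 ≠ 0 := BallModel.ne_zero_of_Q_neg hQneg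
    have hlift : (T : Matrix (Fin 3) (Fin 3) ℂ) *ᵥ BallModel.lift (negConeToBall hT hv') =
        (((↑T⁻¹ : Matrix (Fin 3) (Fin 3) ℂ) *ᵥ v) 2)⁻¹ • v := by
      unfold negConeToBall
      rw [UnitaryBallUniformisationDatum.lift_proj, mulVec_smul, mulVec_mulVec, ← Units.val_mul, mul_inv_cancel,
        Units.val_one, one_mulVec]
    refine ⟨negConeToBall hT hv', ?_⟩
    rw [← hι, hlift, D.unif_smul (inv_ne_zero h2) hv, hvQ]
  · rintro _ ⟨z, rfl⟩
    exact ⟨_, hι z⟩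

namespace RecordSystem

/-! ### §2.2 (L1) `T_b` maps the piece through `a` onto the piece through `ab` -/

/-- **(L1) A Hecke translate maps the complex points of the piece `[a]_Λ` of `(M_Λ)_τ` ONTO those of the piece `[ab]_{K″}` of `(M_{K″})_τ`.**
For `S.IsHeckeTranslate Λ K″ b T_b` ([Milne2005ShimuraVarieties] p. 118 «`[x, aK] ↦ [x, agK′]`») and pieces `ι : Y ⟶ (M_Λ)_τ` through the
representative `a` and `ι″ : Y″ ⟶ (M_{K″})_τ` through any representative `a″` of the class `[ab]_{K″}` (each with its ball datum and
`pieces` clause), `(T_b)_τ (ι(Y(ℂ))) = ι″(Y″(ℂ))` — set-theoretically, ONE presentation per level.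
[cite: Milne2005ShimuraVarieties, Thm. 13.6 p. 118 L21–28 and Lemma 5.13 p. 57] [cite: Deligne1979ShimuraVarieties, 2.1.2–2.1.4] -/
theorem image_baseChange_heckeTranslate_range_piece (S : RecordSystem L H τ T hT K₀) {Λ K'' : C5.SmallLevel K₀}
    {b : finAdelic (↥(maximalRealSubfield L)) L (IsCMField.complexConj L) 3 H} {Tb : S.M.obj Λ ⟶ S.M.obj K''}
    (hTb : S.IsHeckeTranslate Λ K'' b Tb)
    {Y : SchemeOver ℂ} (D : UnitaryBallUniformisationDatum 2 Y) (hD : D.Hℂ = H.map τ)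
    (ι : Y ⟶ (Motives.baseChangeHom τ).obj (S.M.obj Λ)) (a : finAdelic (↥(maximalRealSubfield L)) L (IsCMField.complexConj L) 3 H)
    (hι : letI : Algebra L ℂ := τ.toAlgebra
      ∀ z : Ball, AlgPoints.map (L := ℂ) ι (D.unif ((T : Matrix (Fin 3) (Fin 3) ℂ) *ᵥ BallModel.lift z)) =
        AlgPoints.baseChangeEquiv τ (S.M.obj Λ) ((S.pts Λ).symm (ShimuraSet.mk L H τ T hT Λ.1.1 z a)))
    {Y'' : SchemeOver ℂ} (D'' : UnitaryBallUniformisationDatum 2 Y'') (hD'' : D''.Hℂ = H.map τ)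
    (ι'' : Y'' ⟶ (Motives.baseChangeHom τ).obj (S.M.obj K'')) (a'' : finAdelic (↥(maximalRealSubfield L)) L (IsCMField.complexConj L) 3 H)
    (hι'' : letI : Algebra L ℂ := τ.toAlgebra
      ∀ z : Ball, AlgPoints.map (L := ℂ) ι'' (D''.unif ((T : Matrix (Fin 3) (Fin 3) ℂ) *ᵥ BallModel.lift z)) =
        AlgPoints.baseChangeEquiv τ (S.M.obj K'') ((S.pts K'').symm (ShimuraSet.mk L H τ T hT K''.1.1 z a'')))
    (hq : (Quotient.mk'' (CosetSpace.pt (rationalToFinAdelic _ L _ 3 H) K''.1.1 (a * b)) :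
        orbitRel.Quotient (rational (↥(maximalRealSubfield L)) L (IsCMField.complexConj L) 3 H)
          (CosetSpace (rationalToFinAdelic (↥(maximalRealSubfield L)) L (IsCMField.complexConj L) 3 H) K''.1.1)) =
      Quotient.mk'' (CosetSpace.pt (rationalToFinAdelic _ L _ 3 H) K''.1.1 a'')) :
    AlgPoints.map (L := ℂ) ((Motives.baseChangeHom τ).map Tb) '' Set.range (AlgPoints.map (L := ℂ) ι) =
      Set.range (AlgPoints.map (L := ℂ) ι'') := by
  letI : Algebra L ℂ := τ.toAlgebra
  rw [range_map_eq_of_unif_eq hT D hD ι _ hι, range_map_eq_of_unif_eq hT D'' hD'' ι'' _ hι'', ← Set.range_comp]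
  -- `(T_b)_τ (bc (pts⁻¹[z, aΛ])) = bc (pts⁻¹[z, abK″])`
  have hcomp : (AlgPoints.map (L := ℂ) ((Motives.baseChangeHom τ).map Tb) ∘ fun z : Ball =>
      AlgPoints.baseChangeEquiv τ (S.M.obj Λ) ((S.pts Λ).symm (ShimuraSet.mk L H τ T hT Λ.1.1 z a))) =
      fun z : Ball => AlgPoints.baseChangeEquiv τ (S.M.obj K'') ((S.pts K'').symm (ShimuraSet.mk L H τ T hT K''.1.1 z (a * b))) := by
    funext z
    simp only [Function.comp_apply]
    rw [← HodgeTheory.baseChangeEquiv_map Tb, S.map_heckeTranslate_pts_symm_mk hTb z a]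
  rw [hcomp]
  -- re-representation of the class `[ab]_{K″}` by `a″`
  have hmk := ShimuraSet.range_mk_eq_of_mk_pt_eq L H τ T hT K''.1.1 hq
  have key : ∀ {u v : finAdelic (↥(maximalRealSubfield L)) L (IsCMField.complexConj L) 3 H},
      Set.range (fun z : Ball => ShimuraSet.mk L H τ T hT K''.1.1 z u) ⊆ Set.range (fun z : Ball => ShimuraSet.mk L H τ T hT K''.1.1 z v) →
        Set.range (fun z : Ball => AlgPoints.baseChangeEquiv τ (S.M.obj K'') ((S.pts K'').symm (ShimuraSet.mk L H τ T hT K''.1.1 z u))) ⊆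
          Set.range (fun z : Ball => AlgPoints.baseChangeEquiv τ (S.M.obj K'') ((S.pts K'').symm (ShimuraSet.mk L H τ T hT K''.1.1 z v))) := by
    intro u v huv x hx
    obtain ⟨z, rfl⟩ := hx
    obtain ⟨z', hz'⟩ := huv (Set.mem_range_self z)
    refine ⟨z', ?_⟩
    change AlgPoints.baseChangeEquiv τ (S.M.obj K'') ((S.pts K'').symm (ShimuraSet.mk L H τ T hT K''.1.1 z' v)) =
      AlgPoints.baseChangeEquiv τ (S.M.obj K'') ((S.pts K'').symm (ShimuraSet.mk L H τ T hT K''.1.1 z u))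
    exact congrArg (fun P => AlgPoints.baseChangeEquiv τ (S.M.obj K'') ((S.pts K'').symm P)) hz'
  exact Set.Subset.antisymm (key hmk.subset) (key hmk.symm.subset)

/-! ### §2.3 (L3) An isomorphism of levels matches the pieces, and `H¹`-classes move along -/

/-- **(L3, isomorphism of pieces) When the translate is an isomorphism of levels, the pieces `[a]_Λ` and `[ab]_{K″}` are isomorphic
compatibly with it.**  Let `e : M_Λ ≅ M_{K″}` with `e.hom` a `b`-translate (the conjugate-level situation `Λ = bK″b⁻¹ ∩ K₀`,
[Milne2005ShimuraVarieties] Thm. 13.6), and let `ι : Y ⟶ (M_Λ)_τ`, `ι″ : Y″ ⟶ (M_{K″})_τ` be LEGS OF COLIMIT COFANS whose summands carry ball data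
(`UnitaryBallUniformisationDatum 2`, hence are geometrically irreducible) with the `pieces` clauses through `a`, resp. a representative `a″`
of `[ab]_{K″}`.  Then there is `φ : Y ≅ Y″` with `φ ≫ ι″ = ι ≫ (e.hom)_τ` (§1 `exists_overIso_piece_of_iso_apex` fed by L1).
[cite: Milne2005ShimuraVarieties, Thm. 13.6 p. 118 and Lemma 5.13 p. 57] [cite: GortzWedhorn2020, §(3.5) Example 3.11 and Exercise 3.16] -/
theorem exists_pieceIso_of_heckeTranslateIso (S : RecordSystem L H τ T hT K₀) {Λ K'' : C5.SmallLevel K₀}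
    {b : finAdelic (↥(maximalRealSubfield L)) L (IsCMField.complexConj L) 3 H} (e : S.M.obj Λ ≅ S.M.obj K'')
    (he : S.IsHeckeTranslate Λ K'' b e.hom)
    {Ξ Ξ'' : Type} {Y : Ξ → SchemeOver ℂ} (D : ∀ q, UnitaryBallUniformisationDatum 2 (Y q))
    {ι : ∀ q, Y q ⟶ (Motives.baseChangeHom τ).obj (S.M.obj Λ)}
    (hcol : IsColimit (Cofan.mk ((Motives.baseChangeHom τ).obj (S.M.obj Λ)) ι))
    {Y'' : Ξ'' → SchemeOver ℂ} (D'' : ∀ q, UnitaryBallUniformisationDatum 2 (Y'' q))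
    {ι'' : ∀ q, Y'' q ⟶ (Motives.baseChangeHom τ).obj (S.M.obj K'')}
    (hcol'' : IsColimit (Cofan.mk ((Motives.baseChangeHom τ).obj (S.M.obj K'')) ι''))
    (q : Ξ) (hD : (D q).Hℂ = H.map τ) (a : finAdelic (↥(maximalRealSubfield L)) L (IsCMField.complexConj L) 3 H)
    (hι : letI : Algebra L ℂ := τ.toAlgebra
      ∀ z : Ball, AlgPoints.map (L := ℂ) (ι q) ((D q).unif ((T : Matrix (Fin 3) (Fin 3) ℂ) *ᵥ BallModel.lift z)) =
        AlgPoints.baseChangeEquiv τ (S.M.obj Λ) ((S.pts Λ).symm (ShimuraSet.mk L H τ T hT Λ.1.1 z a)))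
    (q'' : Ξ'') (hD'' : (D'' q'').Hℂ = H.map τ) (a'' : finAdelic (↥(maximalRealSubfield L)) L (IsCMField.complexConj L) 3 H)
    (hι'' : letI : Algebra L ℂ := τ.toAlgebra
      ∀ z : Ball, AlgPoints.map (L := ℂ) (ι'' q'') ((D'' q'').unif ((T : Matrix (Fin 3) (Fin 3) ℂ) *ᵥ BallModel.lift z)) =
        AlgPoints.baseChangeEquiv τ (S.M.obj K'') ((S.pts K'').symm (ShimuraSet.mk L H τ T hT K''.1.1 z a'')))
    (hq : (Quotient.mk'' (CosetSpace.pt (rationalToFinAdelic _ L _ 3 H) K''.1.1 (a * b)) :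
        orbitRel.Quotient (rational (↥(maximalRealSubfield L)) L (IsCMField.complexConj L) 3 H)
          (CosetSpace (rationalToFinAdelic (↥(maximalRealSubfield L)) L (IsCMField.complexConj L) 3 H) K''.1.1)) =
      Quotient.mk'' (CosetSpace.pt (rationalToFinAdelic _ L _ 3 H) K''.1.1 a'')) :
    ∃ φ : Y q ≅ Y'' q'', φ.hom ≫ ι'' q'' = ι q ≫ (Motives.baseChangeHom τ).map e.hom := by
  letI : Algebra L ℂ := τ.toAlgebra
  haveI : ∀ j, PreconnectedSpace (Y'' j).left := fun j =>
    haveI := (D'' j).isSmoothProjective.geometricallyIrreducible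
    haveI := GeometricallyIrreducible.irreducibleSpace_of_subsingleton (Y'' j).hom
    inferInstance
  haveI : ConnectedSpace (Y q).left :=
    haveI := (D q).isSmoothProjective.geometricallyIrreducible
    haveI := GeometricallyIrreducible.irreducibleSpace_of_subsingleton (Y q).hom
    inferInstance
  -- one witness point: the image of `unif (T·(z₀,1))` for any `z₀ ∈ 𝔹²`
  have himg := S.image_baseChange_heckeTranslate_range_piece he (D q) hD (ι q) a hι (D'' q'') hD'' (ι'' q'') a'' hι'' hq
  let z₀ : Ball := BallModel.x₀
  set P₀ : ComplexPoints (Y q) := (D q).unif ((T : Matrix (Fin 3) (Fin 3) ℂ) *ᵥ BallModel.lift z₀)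
  have hmem : AlgPoints.map (L := ℂ) ((Motives.baseChangeHom τ).map e.hom) (AlgPoints.map (L := ℂ) (ι q) P₀) ∈
      Set.range (AlgPoints.map (L := ℂ) (ι'' q'')) := by
    rw [← himg]
    exact ⟨_, ⟨P₀, rfl⟩, rfl⟩
  obtain ⟨Q, hQ⟩ := hmem
  have hx : ((Motives.baseChangeHom τ).mapIso e).hom.left ((ι q).left P₀.pt) ∈ Set.range (ι'' q'').left := by
    refine ⟨Q.pt, ?_⟩
    have h1 := congrArg AlgPoints.pt hQ
    rw [AlgPoints.pt_map, AlgPoints.pt_map, AlgPoints.pt_map] at h1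
    exact h1
  exact Literature.AlgebraicGeometry.Morphisms.exists_overIso_piece_of_iso_apex hcol hcol'' q q''
    ((Motives.baseChangeHom τ).mapIso e) hx

/-- **(L3, cohomology) A class non-zero on the piece `[ab]_{K″}` pulls back under `(T_b)_τ` to a class non-zero on the piece `[a]_Λ`**, when
`T_b = e.hom` is an isomorphism of levels: on `Hⁿ((M_{K″})_τ(ℂ); ℂ)`, `ι″^* x ≠ 0 ⇒ ι^* ((e.hom)_τ^* x) ≠ 0` (the matched piece isomorphism of
`exists_pieceIso_of_heckeTranslateIso` is an isomorphism on cohomology; at `n = 1` the tree's `schemeBettiPullAlong τ e.hom` by `rfl`).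
[cite: Milne2005ShimuraVarieties, Thm. 13.6 p. 118] [cite: HatcherAT2002, §3.1 p. 201–202] [cite: Deligne1979ShimuraVarieties, 2.1.2–2.1.4] -/
theorem complexBetti_map_piece_ne_zero_of_heckeTranslateIso (S : RecordSystem L H τ T hT K₀) {Λ K'' : C5.SmallLevel K₀}
    {b : finAdelic (↥(maximalRealSubfield L)) L (IsCMField.complexConj L) 3 H} (e : S.M.obj Λ ≅ S.M.obj K'')
    (he : S.IsHeckeTranslate Λ K'' b e.hom)
    {Ξ Ξ'' : Type} {Y : Ξ → SchemeOver ℂ} (D : ∀ q, UnitaryBallUniformisationDatum 2 (Y q))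
    {ι : ∀ q, Y q ⟶ (Motives.baseChangeHom τ).obj (S.M.obj Λ)}
    (hcol : IsColimit (Cofan.mk ((Motives.baseChangeHom τ).obj (S.M.obj Λ)) ι))
    {Y'' : Ξ'' → SchemeOver ℂ} (D'' : ∀ q, UnitaryBallUniformisationDatum 2 (Y'' q))
    {ι'' : ∀ q, Y'' q ⟶ (Motives.baseChangeHom τ).obj (S.M.obj K'')}
    (hcol'' : IsColimit (Cofan.mk ((Motives.baseChangeHom τ).obj (S.M.obj K'')) ι''))
    (q : Ξ) (hD : (D q).Hℂ = H.map τ) (a : finAdelic (↥(maximalRealSubfield L)) L (IsCMField.complexConj L) 3 H)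
    (hι : letI : Algebra L ℂ := τ.toAlgebra
      ∀ z : Ball, AlgPoints.map (L := ℂ) (ι q) ((D q).unif ((T : Matrix (Fin 3) (Fin 3) ℂ) *ᵥ BallModel.lift z)) =
        AlgPoints.baseChangeEquiv τ (S.M.obj Λ) ((S.pts Λ).symm (ShimuraSet.mk L H τ T hT Λ.1.1 z a)))
    (q'' : Ξ'') (hD'' : (D'' q'').Hℂ = H.map τ) (a'' : finAdelic (↥(maximalRealSubfield L)) L (IsCMField.complexConj L) 3 H)
    (hι'' : letI : Algebra L ℂ := τ.toAlgebra
      ∀ z : Ball, AlgPoints.map (L := ℂ) (ι'' q'') ((D'' q'').unif ((T : Matrix (Fin 3) (Fin 3) ℂ) *ᵥ BallModel.lift z)) =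
        AlgPoints.baseChangeEquiv τ (S.M.obj K'') ((S.pts K'').symm (ShimuraSet.mk L H τ T hT K''.1.1 z a'')))
    (hq : (Quotient.mk'' (CosetSpace.pt (rationalToFinAdelic _ L _ 3 H) K''.1.1 (a * b)) :
        orbitRel.Quotient (rational (↥(maximalRealSubfield L)) L (IsCMField.complexConj L) 3 H)
          (CosetSpace (rationalToFinAdelic (↥(maximalRealSubfield L)) L (IsCMField.complexConj L) 3 H) K''.1.1)) =
      Quotient.mk'' (CosetSpace.pt (rationalToFinAdelic _ L _ 3 H) K''.1.1 a''))
    (n : ℕ) {x : HodgeTheory.complexBetti ((Motives.baseChangeHom τ).obj (S.M.obj K'')) n}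
    (hx : (HodgeTheory.complexBetti.map (ι'' q'') n).hom x ≠ 0) :
    (HodgeTheory.complexBetti.map (ι q) n).hom ((HodgeTheory.complexBetti.map ((Motives.baseChangeHom τ).map e.hom) n).hom x) ≠ 0 := by
  obtain ⟨φ, hφ⟩ := S.exists_pieceIso_of_heckeTranslateIso e he D hcol D'' hcol'' q hD a hι q'' hD'' a'' hι'' hq
  exact Literature.AlgebraicGeometry.Morphisms.complexBetti_map_inj_ne_zero_of_iso _ φ hφ n hx

end RecordSystem

end Literature.AlgebraicGeometry.ShimuraVarieties.UnitaryCanonicalModel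

end
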